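/-
Copyright (c) 2026. All rights reserved.
Released under Apache 2.0 license as described in the file LICENSE.
Authors: abc-iut cell, seat abc-iut-w5-d226 (gen 4; cone node `AbsTopIII:Prop4.2(i)` — the printed item
(i) at the archimedean models of [AbsTopIII] §4, all four types `T`, assembled in one statement).
-/
import Literature.AnabelianGeometry.AbsoluteAnabelian.ArchimedeanHolMonoidPairsLogFrobenius
import Literature.AnabelianGeometry.AbsoluteAnabelian.AbsTopIII.AutHolLogFrobeniusModelProofs
import Literature.AnabelianGeometry.AbsoluteAnabelian.AbsTopIII.AutHolLogFrobeniusGaloisModel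
import Literature.AnabelianGeometry.AbsoluteAnabelian.ArchimedeanHolFieldFunctorGeometricPuncturedEllipticCor45
import HarnessLib

/-!
# [AbsTopIII] Prop 4.2 (i) — bijection `Isom_𝒞 ⥲ Isom_EA`, `𝒞^hol_T = 𝒞̲^hol_T`, id-rigidity — at the
# archimedean models for EVERY interface datum and all four `T`, in ONE statement

S. Mochizuki, *Topics in Absolute Anabelian Geometry III*, Prop 4.2 (i), kurims manuscript p. 105
l. 54–74, proof p. 106 l. 8–25 (lit key `paper:url-5493eb38cbb7`, read on the page; bib key
`MochizukiAbsTopIII2015`):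

> (i) Let `T ∈ {TM, TF, TLG, TCG}`; `(𝕏 ↶ M), (𝕏* ↶ M*) ∈ Ob(𝒞^hol_T)`.  Then the natural functor of
> Definition 4.1, (iii), induces a bijection [cf. Proposition 3.2, (iv)]
> `Isom_{𝒞^hol_T}((𝕏 ↶ M),(𝕏* ↶ M*)) ⥲ Isom_EA(𝕏, 𝕏*)` on sets of isomorphisms.  In particular, the
> categories `EA`, `𝒞^hol_T = 𝒞̲^hol_T`, `𝒞^{hol-sB}_T = 𝒞̲^{hol-sB}_T` are id-rigid.
>
> Proof. The bijectivity portion of assertion (i) follows immediately from the required compatibility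
> of morphisms of `𝒞^hol_T` with the Kummer structures of the objects involved [cf. also the functorial
> algorithms of Corollary 2.7]. To verify the id-rigidity of `EA`, … by Corollary 2.3, (i) [cf. also
> [Mzk14], Lemma 1.3, (iii)] … "`Loc_R(X)`" …. Thus, the id-rigidity of `EA` follows immediately from
> the slimness assertion of Lemma 4.3 below. In light of the bijectivity portion of assertion (i), the
> id-rigidity of the categories `𝒞^hol_T = 𝒞̲^hol_T`, `𝒞^{hol-sB}_T = 𝒞̲^{hol-sB}_T` follows in a similar
> fashion.

PROOF-ONLY companion (abc-iut cell, cone node `AbsTopIII:Prop4.2(i)`; no notion is declared) of the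
typer's landed statement files `ArchimedeanLogFrobenius.lean` / `ArchimedeanLogFrobeniusFunctors.lean`
(abc-iut-L4-t2 / abc-iut-L4-t14: item (i) "not typed — needs Cor 2.7 functoriality") and the sub-DAG file
`ArchimedeanLogFrobeniusProp42Sub.lean` (plan/L4/SUBDAG-AbsTopIII-Prop42.md rows P42.i/L02–L12).  At
the archimedean MODEL of §4 over the Cor 2.7 (e)+functoriality interface `𝔄 : AutHolFieldFunctor` the
categories are packaged (`𝒞^hol_TF = HolTFPair 𝔄`, abc-iut-L4-t10; `𝒞^hol_T = HolMonoidPair 𝔄 T`,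
`T ∈ {TM, TLG, TCG}`, abc-iut-w5-d226) and item (i) is proved piecewise in four files
(`HolTFPair.mapIso_toEA_bijective` / `isIdRigid_of_isIdRigid_EA`, `HolMonoidPair.mapIso_toEA_bijective` /
`Hom.arith_bijective` / `isIdRigid_of_isIdRigid_EA`).  THIS FILE assembles item (i) as ONE statement per
printed sentence, for every `𝔄` and all four printed `T`, adds the two pieces not yet in the tree —
`𝒞^hol_TF = 𝒞̲^hol_TF` (`HolTFPair.Hom.arith_bijective`, `continuous_arith_symm`) and the `sB` clause
(the full subcategory of `𝒞^hol_T` over ANY object property `S` of `EA` — print: "of strictly Belyi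
type" — is id-rigid as soon as the full subcategory `EA_S ⊆ EA` is: `isIdRigid_fullSubcategory_of_EA`,
by the restricted equivalence `EA_S ≌ 𝒞^{hol-S}_T`, "in light of the bijectivity portion") — and reads
the id-rigidity sentence at the model families where its ONE input, the id-rigidity of `EA` ("from the
slimness assertion of Lemma 4.3"), is a THEOREM of the tree:

* `prop_4_2_i_bijectivity_arch 𝔄` — ZERO binders: the bijection `Isom_𝒞 ⥲ Isom_EA` for all four `T`, and
  `𝒞^hol_T = 𝒞̲^hol_T` for all four `T` (every morphism's `φ_M` is an isomorphism of `T`: bijective with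
  continuous inverse);
* `prop_4_2_i_idRigid_arch 𝔄` — ZERO binders, the id-rigidity sentence in the shape print proves it:
  `IsIdRigid EA → (IsIdRigid 𝒞^hol_T, all four T)` and `∀ S, IsIdRigid EA_S → (IsIdRigid 𝒞^{hol-S}_T, all
  four T)`;
* `prop_4_2_i_arch 𝔄 (hE : IsIdRigid 𝔄.EA)` — item (i) flat, AT READING "`EA` id-rigid" (the input print
  derives from Lemma 4.3 via Cor 2.3 (i) / `Loc_R(X)`; at the abstract interface `EA` is a datum);
* the id-rigidity sentence OUTRIGHT where that input is landed: the Galois-category instance `EA = B(Π)`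
  from the SLIMNESS of `Π` (Lemma 4.3's conclusion, abc-iut-L4-t10's `isIdRigid_EA_ofGaloisCategory` over
  `isIdRigid_bCat_of_isSlimGroup`) — `prop_4_2_i_idRigid_ofGaloisCategory`; unconditionally at
  `Π = G_{ℚ_p}`; and at abc-iut-L4-t14's GEOMETRIC `EA^hol_RS(Q)` for `Q =` "finite étale over a
  once-punctured elliptic curve" — the elliptically admissible archetype — UNCONDITIONALLY
  (abc-iut-w5-d144 / abc-iut-L4-t10's `HolRS.isIdRigid_EA_puncturedTorusCovers`,
  `isIdRigid_EA_mapsTo_of_isPuncturedEllipticCurve`): `HolRS.prop_4_2_i_idRigid_puncturedTorusCovers`,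
  `HolRS.prop_4_2_i_idRigid_mapsTo_of_isPuncturedEllipticCurve`.

HONEST SCOPE: model-level over the named interface (model ≠ reconstruction); Rmk 4.2.1 (the `𝒞̲̲`/`𝒞̲̲̲`
versions are NOT id-rigid) is abc-iut-w5-d226's `ArchimedeanHolPairsRigidityProofs` and is not restated.
Refereed pre-IUT anabelian geometry; nothing here bears on [IUTchIII] Cor. 3.12 or takes a side; typed
≠ proved except where a proof is given.
-/

noncomputable section

namespace Literature.AnabelianGeometry.AbsoluteAnabelian

open _root_.CategoryTheory _root_.Topology
open Literature.AlgebraicGeometry.Frobenioids (IsSlimGroup)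

universe u

/-! ### `𝒞^hol_TF = 𝒞̲^hol_TF`: every morphism of `TF`-pairs is a `TF`-isomorphism -/

namespace HolTFPair

variable {𝔄 : AutHolFieldFunctor.{u}}

/-- **`𝒞^hol_TF = 𝒞̲^hol_TF`**: the arithmetic part `φ_M : k₁ → k₂` of EVERY morphism of `TF`-pairs is
bijective — it is the field isomorphism `κ₂⁻¹ ∘ 𝒜_{φ_𝕏} ∘ κ₁` (abc-iut-L4-t10's `Hom.arith_apply`).
[cite: MochizukiAbsTopIII2015, Proposition 4.2 (i) p.105] -/
theorem Hom.arith_bijective {P Q : HolTFPair 𝔄} (φ : P ⟶ Q) : Function.Bijective φ.arith := by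
  have h : ⇑φ.arith = ⇑((P.κ.trans (𝔄.Amap φ.base)).trans Q.κ.symm) :=
    funext fun m => Hom.arith_apply φ m
  rw [h]
  exact RingEquiv.bijective _

/-- … and its inverse is continuous (it is `κ₁⁻¹ ∘ 𝒜_{φ_𝕏}⁻¹ ∘ κ₂`), so `φ_M` is an isomorphism of
topological fields, i.e. a `TF`-isomorphism (Def 4.1 (ii)). [cite: MochizukiAbsTopIII2015, Proposition 4.2 (i) p.105] -/
theorem Hom.continuous_arith_symm {P Q : HolTFPair 𝔄} (φ : P ⟶ Q) :
    Continuous (Equiv.ofBijective φ.arith (Hom.arith_bijective φ)).symm := by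
  have h : ∀ y, (Equiv.ofBijective φ.arith (Hom.arith_bijective φ)).symm y =
      P.κ.symm ((𝔄.Amap φ.base).symm (Q.κ y)) := fun y => by
    apply (Hom.arith_bijective φ).1
    rw [Equiv.ofBijective_apply_symm_apply φ.arith (Hom.arith_bijective φ) y, Hom.arith_apply]
    simp
  rw [show ⇑(Equiv.ofBijective φ.arith (Hom.arith_bijective φ)).symm =
      fun y => P.κ.symm ((𝔄.Amap φ.base).symm (Q.κ y)) from funext h]
  exact P.continuous_κ_symm.comp ((𝔄.continuous_Amap_symm _).comp Q.continuous_κ)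

/-- **The `sB` clause for `𝒞^hol_TF`** ("the id-rigidity of … `𝒞^{hol-sB}_T = 𝒞̲^{hol-sB}_T` follows in a
similar fashion"): for ANY object property `S` of `EA` (print: "of strictly Belyi type"), if the full
subcategory `EA_S ⊆ EA` is id-rigid then so is the full subcategory `𝒞^{hol-S}_TF ⊆ 𝒞^hol_TF` of pairs whose
structure-orbispace satisfies `S` — the equivalence `𝕏 ↦ (𝕏 ↶ 𝒜_𝕏)`, `(𝕏 ↶ k) ↦ 𝕏` restricts to
`EA_S ≌ 𝒞^{hol-S}_TF` (its isomorphisms lie over identities of `EA`).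
[cite: MochizukiAbsTopIII2015, Proposition 4.2 (i) p.106] -/
theorem isIdRigid_fullSubcategory_of_EA (S : ObjectProperty 𝔄.EA) (hS : IsIdRigid S.FullSubcategory) :
    IsIdRigid (ObjectProperty.FullSubcategory (fun P : HolTFPair 𝔄 => S P.X)) := by
  let S' : ObjectProperty (HolTFPair 𝔄) := fun P => S P.X
  let F : S.FullSubcategory ⥤ S'.FullSubcategory := S'.lift (S.ι ⋙ ofEA 𝔄) fun X => X.property
  let G : S'.FullSubcategory ⥤ S.FullSubcategory := S.lift (S'.ι ⋙ toEA 𝔄) fun P => P.property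
  let η : 𝟭 S.FullSubcategory ≅ F ⋙ G :=
    NatIso.ofComponents (fun X => S.isoMk (Iso.refl _)) (fun {X Y} f => by
      ext
      change f.hom ≫ 𝟙 Y.obj = 𝟙 X.obj ≫ f.hom
      rw [Category.comp_id, Category.id_comp])
  let ε : G ⋙ F ≅ 𝟭 S'.FullSubcategory :=
    NatIso.ofComponents (fun P => S'.isoMk (etaIso P.obj)) (fun {P Q} f => by
      ext
      apply Hom.ext_of_base
      change f.hom.base ≫ 𝟙 Q.obj.X = 𝟙 P.obj.X ≫ f.hom.base
      rw [Category.comp_id, Category.id_comp])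
  haveI : F.IsEquivalence := Functor.IsEquivalence.mk' G η ε
  exact isIdRigid_of_equivalence' F.asEquivalence hS

end HolTFPair

namespace HolMonoidPair

variable {𝔄 : AutHolFieldFunctor.{u}} {T : ArchPairType}

/-- **The `sB` clause for `𝒞^hol_T`, `T ∈ {TM, TLG, TCG}`**: for any object property `S` of `EA`, if `EA_S` is
id-rigid then so is the full subcategory `𝒞^{hol-S}_T ⊆ 𝒞^hol_T` of pairs over `S` (restricted equivalence
`𝕏 ↦ (𝕏 ↶ M_T(𝒜_𝕏))`). [cite: MochizukiAbsTopIII2015, Proposition 4.2 (i) p.106] -/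
theorem isIdRigid_fullSubcategory_of_EA (hT : T.IsMonoidType) (S : ObjectProperty 𝔄.EA)
    (hS : IsIdRigid S.FullSubcategory) :
    IsIdRigid (ObjectProperty.FullSubcategory (fun P : HolMonoidPair 𝔄 T => S P.X)) := by
  let S' : ObjectProperty (HolMonoidPair 𝔄 T) := fun P => S P.X
  let F : S.FullSubcategory ⥤ S'.FullSubcategory := S'.lift (S.ι ⋙ ofEA 𝔄 hT) fun X => X.property
  let G : S'.FullSubcategory ⥤ S.FullSubcategory := S.lift (S'.ι ⋙ toEA 𝔄 T) fun P => P.property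
  let η : 𝟭 S.FullSubcategory ≅ F ⋙ G :=
    NatIso.ofComponents (fun X => S.isoMk (Iso.refl _)) (fun {X Y} f => by
      ext
      change f.hom ≫ 𝟙 Y.obj = 𝟙 X.obj ≫ f.hom
      rw [Category.comp_id, Category.id_comp])
  let ε : G ⋙ F ≅ 𝟭 S'.FullSubcategory :=
    NatIso.ofComponents (fun P => S'.isoMk (etaIso P.obj)) (fun {P Q} f => by
      ext
      apply Hom.ext_of_base
      change f.hom.base ≫ 𝟙 Q.obj.X = 𝟙 P.obj.X ≫ f.hom.base
      rw [Category.comp_id, Category.id_comp])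
  haveI : F.IsEquivalence := Functor.IsEquivalence.mk' G η ε
  exact isIdRigid_of_equivalence' F.asEquivalence hS

end HolMonoidPair

namespace AbsTopIII

variable (𝔄 : AutHolFieldFunctor.{u})

/-! ### The bijectivity portion and `𝒞 = 𝒞̲`, zero binders -/

/-- **[AbsTopIII] Prop 4.2 (i), bijectivity portion and `𝒞^hol_T = 𝒞̲^hol_T`, at the archimedean MODEL for
EVERY interface datum `𝔄`, with NO further hypothesis, for all four `T ∈ {TM, TF, TLG, TCG}`**: "the natural
functor of Definition 4.1, (iii), induces a bijection `Isom_{𝒞^hol_T}((𝕏 ↶ M),(𝕏* ↶ M*)) ⥲ Isom_EA(𝕏, 𝕏*)`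
on sets of isomorphisms" (`T = TF`: abc-iut-L4-t10's `HolTFPair.mapIso_toEA_bijective`; monoid types:
abc-iut-w5-d226's `HolMonoidPair.mapIso_toEA_bijective`), and every morphism of `𝒞^hol_T` has arithmetic
part `φ_M` an isomorphism of `T` (bijective, continuous, continuous inverse): `𝒞^hol_T = 𝒞̲^hol_T`.
[cite: MochizukiAbsTopIII2015, Proposition 4.2 (i) p.105] -/
theorem prop_4_2_i_bijectivity_arch :
    (∀ P Q : HolTFPair 𝔄, Function.Bijective fun φ : P ≅ Q => (HolTFPair.toEA 𝔄).mapIso φ) ∧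
      (∀ (T : ArchPairType) (P Q : HolMonoidPair 𝔄 T),
        Function.Bijective fun φ : P ≅ Q => (HolMonoidPair.toEA 𝔄 T).mapIso φ) ∧
      (∀ (P Q : HolTFPair 𝔄) (φ : P ⟶ Q), ∃ h : Function.Bijective φ.arith,
        Continuous φ.arith ∧ Continuous (Equiv.ofBijective φ.arith h).symm) ∧
      (∀ (T : ArchPairType) (P Q : HolMonoidPair 𝔄 T) (φ : P ⟶ Q), ∃ h : Function.Bijective φ.arith,
        Continuous φ.arith ∧ Continuous (Equiv.ofBijective φ.arith h).symm) :=
  ⟨HolTFPair.mapIso_toEA_bijective, fun _ P Q => HolMonoidPair.mapIso_toEA_bijective P Q,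
    fun _ _ φ => ⟨HolTFPair.Hom.arith_bijective φ, φ.continuous_arith, HolTFPair.Hom.continuous_arith_symm φ⟩,
    fun _ _ _ φ => ⟨HolMonoidPair.Hom.arith_bijective φ, φ.continuous_arith,
      HolMonoidPair.Hom.continuous_arith_symm φ⟩⟩

/-! ### The id-rigidity sentence -/

/-- **[AbsTopIII] Prop 4.2 (i), the id-rigidity sentence, in the shape print proves it, ZERO binders**:
"In light of the bijectivity portion of assertion (i)", IF `EA` is id-rigid THEN so is `𝒞^hol_T = 𝒞̲^hol_T`
for all four `T`; and for every object property `S` of `EA` ("of strictly Belyi type"), IF `EA_S` is id-rigid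
THEN so is `𝒞^{hol-S}_T = 𝒞̲^{hol-S}_T` for all four `T`.  (The antecedent — "the id-rigidity of `EA` follows
immediately from the slimness assertion of Lemma 4.3", via Cor 2.3 (i) / `Loc_R(X)` — is a datum of the
abstract interface; see the instances below where it is a theorem.)
[cite: MochizukiAbsTopIII2015, Proposition 4.2 (i) p.106] -/
theorem prop_4_2_i_idRigid_arch :
    (IsIdRigid 𝔄.EA →
        IsIdRigid (HolTFPair 𝔄) ∧ ∀ (T : ArchPairType), T.IsMonoidType → IsIdRigid (HolMonoidPair 𝔄 T)) ∧
      ∀ S : ObjectProperty 𝔄.EA, IsIdRigid S.FullSubcategory →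
        IsIdRigid (ObjectProperty.FullSubcategory (fun P : HolTFPair 𝔄 => S P.X)) ∧
          ∀ (T : ArchPairType), T.IsMonoidType →
            IsIdRigid (ObjectProperty.FullSubcategory (fun P : HolMonoidPair 𝔄 T => S P.X)) :=
  ⟨fun hE => ⟨HolTFPair.isIdRigid_of_isIdRigid_EA 𝔄 hE,
      fun _ hT => HolMonoidPair.isIdRigid_of_isIdRigid_EA hT hE⟩,
    fun S hS => ⟨HolTFPair.isIdRigid_fullSubcategory_of_EA S hS,
      fun _ hT => HolMonoidPair.isIdRigid_fullSubcategory_of_EA hT S hS⟩⟩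

/-! ### Item (i) in one statement, AT READING "`EA` id-rigid" -/

/-- **[AbsTopIII] Prop 4.2 (i) at the archimedean MODEL of §4 for EVERY interface datum `𝔄`, all four
`T ∈ {TM, TF, TLG, TCG}`, AT READING "`EA` is id-rigid"** (print: ⟸ Lemma 4.3 via Cor 2.3 (i)): the bijection
`Isom_𝒞 ⥲ Isom_EA`; `𝒞^hol_T = 𝒞̲^hol_T`; "the categories `EA`, `𝒞^hol_T = 𝒞̲^hol_T`, `𝒞^{hol-sB}_T = 𝒞̲^{hol-sB}_T`
are id-rigid" — the last for every object property `S` of `EA` whose `EA_S` is id-rigid.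
[cite: MochizukiAbsTopIII2015, Proposition 4.2 (i) pp.105–106] -/
theorem prop_4_2_i_arch (hE : IsIdRigid 𝔄.EA) :
    (∀ P Q : HolTFPair 𝔄, Function.Bijective fun φ : P ≅ Q => (HolTFPair.toEA 𝔄).mapIso φ) ∧
      (∀ (T : ArchPairType) (P Q : HolMonoidPair 𝔄 T),
        Function.Bijective fun φ : P ≅ Q => (HolMonoidPair.toEA 𝔄 T).mapIso φ) ∧
      (∀ (P Q : HolTFPair 𝔄) (φ : P ⟶ Q), ∃ h : Function.Bijective φ.arith,
        Continuous φ.arith ∧ Continuous (Equiv.ofBijective φ.arith h).symm) ∧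
      (∀ (T : ArchPairType) (P Q : HolMonoidPair 𝔄 T) (φ : P ⟶ Q), ∃ h : Function.Bijective φ.arith,
        Continuous φ.arith ∧ Continuous (Equiv.ofBijective φ.arith h).symm) ∧
      IsIdRigid 𝔄.EA ∧ IsIdRigid (HolTFPair 𝔄) ∧
      (∀ (T : ArchPairType), T.IsMonoidType → IsIdRigid (HolMonoidPair 𝔄 T)) ∧
      ∀ S : ObjectProperty 𝔄.EA, IsIdRigid S.FullSubcategory →
        IsIdRigid (ObjectProperty.FullSubcategory (fun P : HolTFPair 𝔄 => S P.X)) ∧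
          ∀ (T : ArchPairType), T.IsMonoidType →
            IsIdRigid (ObjectProperty.FullSubcategory (fun P : HolMonoidPair 𝔄 T => S P.X)) :=
  have hb := prop_4_2_i_bijectivity_arch 𝔄
  have hr := prop_4_2_i_idRigid_arch 𝔄
  ⟨hb.1, hb.2.1, hb.2.2.1, hb.2.2.2, hE, (hr.1 hE).1, (hr.1 hE).2, hr.2⟩

/-! ### … and OUTRIGHT where the id-rigidity of `EA` is a theorem of the tree -/

variable {G : Type} [Group G] [TopologicalSpace G]

/-- **The id-rigidity sentence of Prop 4.2 (i) at the Galois-category instance `EA = B(Π)` FROM SLIMNESS**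
— the printed route "the id-rigidity of `EA` follows immediately from the slimness assertion of Lemma 4.3"
read kernel-exactly (Lemma 4.3's conclusion `Π_X` slim is the tree's `IsSlimGroup`; [SemiAnbd]/[FrdI] §0
slim ⇒ `B(Π)` id-rigid = `isIdRigid_bCat_of_isSlimGroup`): for every slim profinite group `Π`, `EA`,
`𝒞^hol_T` (all four `T`) are id-rigid, and so is every `𝒞^{hol-S}_T` with `EA_S` id-rigid.
[cite: MochizukiAbsTopIII2015, Proposition 4.2 (i) p.106] -/
theorem prop_4_2_i_idRigid_ofGaloisCategory [IsTopologicalGroup G] [CompactSpace G] [T2Space G]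
    [TotallyDisconnectedSpace G] (hG : IsSlimGroup G) :
    let 𝔄 := AutHolFieldFunctor.ofGaloisCategory G
    IsIdRigid 𝔄.EA ∧ IsIdRigid (HolTFPair 𝔄) ∧
      (∀ (T : ArchPairType), T.IsMonoidType → IsIdRigid (HolMonoidPair 𝔄 T)) ∧
      ∀ S : ObjectProperty 𝔄.EA, IsIdRigid S.FullSubcategory →
        IsIdRigid (ObjectProperty.FullSubcategory (fun P : HolTFPair 𝔄 => S P.X)) ∧
          ∀ (T : ArchPairType), T.IsMonoidType →
            IsIdRigid (ObjectProperty.FullSubcategory (fun P : HolMonoidPair 𝔄 T => S P.X)) :=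
  have hE := AutHolFieldFunctor.isIdRigid_EA_ofGaloisCategory hG
  (prop_4_2_i_arch _ hE).2.2.2.2

/-- … UNCONDITIONALLY at `Π = G_{ℚ_p}` (slim: [pGC] Lemma 15.8, proved in the tree —
`isSlimGroup_absoluteGaloisGroup_padic`). [cite: MochizukiAbsTopIII2015, Proposition 4.2 (i) p.106] -/
theorem prop_4_2_i_idRigid_absoluteGaloisGroup_padic (p : ℕ) [Fact p.Prime] :
    let 𝔄 := AutHolFieldFunctor.ofGaloisCategory (Field.absoluteGaloisGroup ℚ_[p])
    IsIdRigid 𝔄.EA ∧ IsIdRigid (HolTFPair 𝔄) ∧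
      (∀ (T : ArchPairType), T.IsMonoidType → IsIdRigid (HolMonoidPair 𝔄 T)) ∧
      ∀ S : ObjectProperty 𝔄.EA, IsIdRigid S.FullSubcategory →
        IsIdRigid (ObjectProperty.FullSubcategory (fun P : HolTFPair 𝔄 => S P.X)) ∧
          ∀ (T : ArchPairType), T.IsMonoidType →
            IsIdRigid (ObjectProperty.FullSubcategory (fun P : HolMonoidPair 𝔄 T => S P.X)) := by
  haveI : CompactSpace (Field.absoluteGaloisGroup ℚ_[p]) :=
    Literature.NumberTheory.GaloisRepresentations.absoluteGaloisGroup_compactSpace ℚ_[p]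
  exact prop_4_2_i_idRigid_ofGaloisCategory (isSlimGroup_absoluteGaloisGroup_padic p)

end AbsTopIII

namespace HolRS

open Literature.Geometry.Kaehler Literature.Geometry.Kaehler.ComplexTorus

/-- **The id-rigidity sentence of Prop 4.2 (i) at the GEOMETRIC `EA^hol_RS(Q)`** (abc-iut-L4-t14's
`geometricAutHolFieldFunctor Q`: connected Riemann surfaces with property `Q`, holomorphic finite étale
morphisms) AT READING "`EA^hol_RS(Q)` id-rigid".
[cite: MochizukiAbsTopIII2015, Proposition 4.2 (i) p.106] -/
theorem prop_4_2_i_idRigid_geometric (Q : ObjectProperty HolRS)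
    (hE : IsIdRigid (geometricAutHolFieldFunctor Q).EA) :
    let 𝔄 := geometricAutHolFieldFunctor Q
    IsIdRigid 𝔄.EA ∧ IsIdRigid (HolTFPair 𝔄) ∧
      (∀ (T : ArchPairType), T.IsMonoidType → IsIdRigid (HolMonoidPair 𝔄 T)) ∧
      ∀ S : ObjectProperty 𝔄.EA, IsIdRigid S.FullSubcategory →
        IsIdRigid (ObjectProperty.FullSubcategory (fun P : HolTFPair 𝔄 => S P.X)) ∧
          ∀ (T : ArchPairType), T.IsMonoidType →
            IsIdRigid (ObjectProperty.FullSubcategory (fun P : HolMonoidPair 𝔄 T => S P.X)) :=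
  (AbsTopIII.prop_4_2_i_arch _ hE).2.2.2.2

variable (Φ : (Fin 2 → ℝ) ≃L[ℝ] ℂ)

/-- **… UNCONDITIONALLY over `EA^hol_RS` of everything finite étale over a punctured complex torus
`ℂ/Φ(ℤ²) ∖ {x₀}`** (the elliptically admissible archetype, Cor 2.7 (a); `EA` id-rigid there is
abc-iut-w5-d144 / abc-iut-L4-t10's `isIdRigid_EA_puncturedTorusCovers`).
[cite: MochizukiAbsTopIII2015, Proposition 4.2 (i) p.106] -/
theorem prop_4_2_i_idRigid_puncturedTorusCovers (x₀ : ComplexTorus Φ) :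
    let 𝔄 := geometricAutHolFieldFunctor (fun Y : HolRS => Nonempty (Y ⟶ puncturedTorus Φ x₀))
    IsIdRigid 𝔄.EA ∧ IsIdRigid (HolTFPair 𝔄) ∧
      (∀ (T : ArchPairType), T.IsMonoidType → IsIdRigid (HolMonoidPair 𝔄 T)) ∧
      ∀ S : ObjectProperty 𝔄.EA, IsIdRigid S.FullSubcategory →
        IsIdRigid (ObjectProperty.FullSubcategory (fun P : HolTFPair 𝔄 => S P.X)) ∧
          ∀ (T : ArchPairType), T.IsMonoidType →
            IsIdRigid (ObjectProperty.FullSubcategory (fun P : HolMonoidPair 𝔄 T => S P.X)) :=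
  prop_4_2_i_idRigid_geometric _ (isIdRigid_EA_puncturedTorusCovers Φ x₀)

/-- **… UNCONDITIONALLY over `EA^hol_RS` of everything finite étale over ANY once-punctured elliptic curve
`𝕏`** (abc-iut-w5-d144's `isIdRigid_mapsTo_of_isPuncturedEllipticCurve`, via abc-iut-L4-t10).
[cite: MochizukiAbsTopIII2015, Proposition 4.2 (i) p.106] -/
theorem prop_4_2_i_idRigid_mapsTo_of_isPuncturedEllipticCurve (X : HolRS)
    (hX : TorsionPointsDenseUniqueGroupLaw.IsPuncturedEllipticCurve X.carrier) :
    let 𝔄 := geometricAutHolFieldFunctor (fun Y : HolRS => Nonempty (Y ⟶ X))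
    IsIdRigid 𝔄.EA ∧ IsIdRigid (HolTFPair 𝔄) ∧
      (∀ (T : ArchPairType), T.IsMonoidType → IsIdRigid (HolMonoidPair 𝔄 T)) ∧
      ∀ S : ObjectProperty 𝔄.EA, IsIdRigid S.FullSubcategory →
        IsIdRigid (ObjectProperty.FullSubcategory (fun P : HolTFPair 𝔄 => S P.X)) ∧
          ∀ (T : ArchPairType), T.IsMonoidType →
            IsIdRigid (ObjectProperty.FullSubcategory (fun P : HolMonoidPair 𝔄 T => S P.X)) :=
  prop_4_2_i_idRigid_geometric _ (isIdRigid_EA_mapsTo_of_isPuncturedEllipticCurve X hX)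

end HolRS

end Literature.AnabelianGeometry.AbsoluteAnabelian

end
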